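import Literature.IUT.HodgeTheaters.InitialThetaDataTorsionCuspModelPoint
import Literature.IUT.HodgeTheaters.InitialThetaDataTorsionCuspModelGeometry
import HarnessLib

/-!
# [IUTchI] Def 3.1 / Def 6.1 (v): the single-point cusp model as a `ThetaGeometry`; `regeom₄`, its `l`-torsion
# monodromy `M′ ⊇ {M, hI}` and cusp Galois action — `{CG, M′}` jointly (NV-L5 row «JOINT-NV-CG (l cusps)», stage C part C2)

S. Mochizuki, *Inter-universal Teichmüller theory I*, kurims manuscript (May 2020), Def 3.1 (b)–(f) p. 61–63, Def 6.1 (v)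
p. 158; [EtTh] Def 2.1 p. 36.  [claim: Mochizuki2012, status: disputed] (D-0012 claim key; series status DISPUTED — a MODEL
of the cell's `π₁`-interface structures; nothing of the series is asserted; no side taken on [IUTchIII] Cor. 3.12).

## WHAT (continuing part C1 `InitialThetaDataTorsionCuspModelPoint.lean`; ambient, `embK₃` and torsion coordinate of parts
B1–B3 unchanged)

* **`geometryOf₄ … : ThetaGeometry (F̄ ≃ₐ[F] F̄) G_K l`** — `geometryOf₃` with `pe := pedOf₄` (single-point inertia);
* **`InitialThetaData.regeom₄ D₀`**, **`torsionMonodromyRegeom₄`**, **`unramifiedTorsionMonodromyRegeom₄ D₀ :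
  D₀.regeom₄.UnramifiedTorsionMonodromy`** (`τ` kills the single-point inertia: it lives in `U = ker pr_T`),
  **`cuspGaloisRegeom₄ D₀ : D₀.regeom₄.geom.pe.CuspGalois`**, and `nonempty_cuspGalois_and_unramified_regeom₄` (`{CG, M′}`
  jointly at `regeom₄`).

HONEST LABEL «[model; `E[l]`-twisted finite shadow `U ⋊ E[l]`; `l` cusps; single-point inertia]».  Model ≠ genuine datum;
typed ≠ proved; no side taken on [IUTchIII] Cor. 3.12.
-/

noncomputable section

namespace Literature.IUT.HodgeTheaters

universe u

namespace TorsionCuspModel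

open Literature.AnabelianGeometry.AbsoluteAnabelian Topology TorsionMonodromyModel ThetaGeometryModel
open Literature.AnabelianGeometry.EtaleTheta.SettingModel
open scoped WeierstrassCurve.Affine Classical

section Geometry

variable {F : Type u} (K : Type u) {Fbar : Type u} [Field F] [Field K] [Field Fbar] [Algebra F Fbar]
  [Algebra K Fbar] (E : WeierstrassCurve F) (l : ℕ)

/-- **The single-point group-ring model of the `π₁`-interface of [IUTchI] Def 3.1 (b)(d)(f)**: `geometryOf₃` with the
§1 datum `pedOf₄` (cusp inertia `⟨(e_{s(q)}, 1, 1)⟩`). [cite: Mochizuki2012, IUTchI Def 3.1 p.61–63] -/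
def geometryOf₄ [Algebra F K] [IsScalarTower F K Fbar] [IsGalois F Fbar] [E.IsElliptic]
    (hK : ∀ σ ∈ galoisSubgroupOf F K Fbar, FixesTorsion E l σ) (hl : l.Prime) (h5 : 5 ≤ l)
    (hcard : Nat.card (Tors E Fbar l) = l ^ 2) (g : Tors E Fbar l) (hg : g ≠ 1) (a : Tors E Fbar l)
    (ha : a ∉ Subgroup.zpowers g) : ThetaGeometry (Fbar ≃ₐ[F] Fbar) (galoisSubgroupOf F K Fbar) l :=
  haveI : NeZero l := ⟨hl.ne_zero⟩
  letI : CompactSpace (galoisSubgroupOf F K Fbar) :=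
    isCompact_iff_compactSpace.mp (ThetaGeometryModel.isClosed_galoisSubgroupOf F K Fbar).isCompact
  { extF := ext F E Fbar l
    galIso := MulEquiv.refl _
    galIso_continuous := ⟨continuous_id, continuous_id⟩
    PiX := PiX F E Fbar l
    PiX_isOpen := PiX_isOpen F E Fbar l
    PiX_normal := PiX_normal F E Fbar l
    PiX_index := PiX_index F E Fbar l
    aug_PiX := by
      rw [eq_top_iff]
      intro σ _
      exact ⟨SemidirectProduct.inr (σ, 1), inr_mem_PiX F E Fbar l σ, rfl⟩
    pe := pedOf₄ F E Fbar l (galoisSubgroupOf F K Fbar) g Quotient.out a hl ha h5 (coprime_six_of_prime l hl h5)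
    pe_l := rfl
    embK := embK₃ hK
    embK_continuous := embK₃_continuous hK
    embK_injective := embK₃_injective hK
    embK_range := by
      ext x
      exact mem_range_embK₃_iff hK x
    galKIso := MulEquiv.refl _
    aug_compat := fun _ => rfl
    embK_PiX := by
      ext x
      constructor
      · rintro ⟨y, hy, rfl⟩
        exact ⟨(mem_PiX_iff F E Fbar l _).mpr ((mem_dX_iff _).mp (mem_liftU.mp hy)), y, rfl⟩
      · rintro ⟨hx, y, rfl⟩
        exact ⟨y, mem_liftU.mpr ((mem_dX_iff _).mpr ((mem_PiX_iff F E Fbar l _).mp hx)), rfl⟩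
    PiXbar_relIndex := by
      show (liftU _ (dX F E Fbar l) ⊓ liftU _ (dC F E g)).relIndex (liftU _ (dX F E Fbar l)) = l
      rw [← liftU_inf, liftU_relIndex]
      exact dXbar_relIndex_dX hl hcard hg
    aug_PiXbar := by
      show Function.Surjective ((MonoidHom.fst _ _).comp (liftU _ (dX F E Fbar l) ⊓ liftU _ (dC F E g)).subtype)
      rw [← liftU_inf]
      exact fst_liftU_surjective _ _
    PiXbar_relIndex_PiCbar := by
      show (liftU _ (dX F E Fbar l) ⊓ liftU _ (dC F E g)).relIndex (liftU _ (dC F E g)) = 2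
      rw [← liftU_inf, liftU_relIndex]
      exact dXbar_relIndex_dC hl hcard hg
    not_PiCbar_le_PiX := by
      intro h
      apply not_dC_le_dX (F := F) (E := E) (Fbar := Fbar) (l := l) g
      intro d hd
      exact h (show ((1 : galoisSubgroupOf F K Fbar), d) ∈ liftU _ (dC F E g) from hd) }

end Geometry

end TorsionCuspModel

namespace InitialThetaData

open TorsionMonodromyModel TorsionCuspModel
open scoped WeierstrassCurve.Affine Classical

variable {F K Fbar : Type u} [Field F] [NumberField F] [Field K] [NumberField K] [Algebra F K] [Field Fbar]
  [Algebra F Fbar] [Algebra K Fbar] {E : WeierstrassCurve F} [E.IsElliptic] {l : ℕ} {Pb : BadPlacePredicates K}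

/-- **The re-geometrised initial Θ-datum (single-point model)**: `D₀` with `geom := geometryOf₄` (hypotheses discharged
from `D₀`: `G_K` fixes `E[l]`, `#E[l] = l²`, `g = lineGen ≠ 1`, `a = coGen ∉ ℤ·g`). [cite: Mochizuki2012, IUTchI Def 3.1 p.61–63] -/
def regeom₄ (D₀ : InitialThetaData F K Fbar E l Pb) : InitialThetaData F K Fbar E l Pb :=
  haveI := D₀.isAlgClosure
  haveI := D₀.isScalarTower
  { D₀ with
    geom := geometryOf₄ K E l D₀.fixesTorsion_of_mem_galoisSubgroupOf D₀.l_prime D₀.five_le_l D₀.card_tors_eq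
      D₀.lineGen D₀.lineGen_ne_one D₀.coGen D₀.coGen_not_mem }

/-- **The `l`-torsion monodromy term of `regeom₄`** (`τ := pt ∘ tc`, `gen := g`; same proof as for `regeom₃` — the
torsion coordinate does not see the cusp inertia). [cite: Mochizuki2012, IUTchI Def 6.1 (v) p.158] -/
def torsionMonodromyRegeom₄ (D₀ : InitialThetaData F K Fbar E l Pb) : D₀.regeom₄.TorsionMonodromy :=
  haveI := D₀.isAlgClosure
  haveI := D₀.isScalarTower
  haveI : NeZero l := ⟨D₀.l_prime.ne_zero⟩
  { tau := fun x => Tors.pt (tc (x : TorsionCuspModel.PiC F E Fbar l))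
    tau_torsion := fun g _ => Tors.torsion_pt _
    tau_mul := fun g hg h _ =>
      pt_tc_mul_of_snd_eq_one ((TorsionCuspModel.mem_PiX_iff F E Fbar l _).mp hg) h
    tau_surjOn := by
      intro P hP
      refine ⟨(SemidirectProduct.inl (SemidirectProduct.inr (Tors.ofPt P hP)) : TorsionCuspModel.PiC F E Fbar l),
        ⟨TorsionCuspModel.inl_mem_PiX F E Fbar l _, ?_⟩, ?_⟩
      · exact (TorsionCuspModel.mem_geom_ext_iff F E Fbar l _).mpr rfl
      · show Tors.pt (tc (SemidirectProduct.inl (SemidirectProduct.inr (Tors.ofPt P hP)) :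
          TorsionCuspModel.PiC F E Fbar l)) = P
        rw [tc_inl, SemidirectProduct.right_inr, Tors.pt_ofPt]
    gen := Tors.pt D₀.lineGen
    gen_torsion := Tors.torsion_pt _
    gen_ne_zero := by
      rw [Ne, Tors.pt_eq_zero_iff]
      exact D₀.lineGen_ne_one
    mem_PiXund_iff := by
      haveI : CompactSpace (galoisSubgroupOf F K Fbar) :=
        isCompact_iff_compactSpace.mp (ThetaGeometryModel.isClosed_galoisSubgroupOf F K Fbar).isCompact
      intro k hk
      obtain ⟨hkX, y, rfl⟩ := hk
      have hy2 : y.2.right = 1 := (TorsionCuspModel.mem_PiX_iff F E Fbar l _).mp hkX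
      change embK₃ D₀.fixesTorsion_of_mem_galoisSubgroupOf y ∈
          (pedOf₄ F E Fbar l (galoisSubgroupOf F K Fbar) D₀.lineGen Quotient.out D₀.coGen
            D₀.l_prime D₀.coGen_not_mem D₀.five_le_l
            (coprime_six_of_prime l D₀.l_prime D₀.five_le_l)).PiXbar.map
            (embK₃ D₀.fixesTorsion_of_mem_galoisSubgroupOf) ↔
        ∃ a : ℤ, Tors.pt (tc (embK₃ D₀.fixesTorsion_of_mem_galoisSubgroupOf y)) = a • Tors.pt D₀.lineGen
      constructor
      · rintro ⟨z, hz, hzy⟩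
        obtain rfl : z = y := embK₃_injective _ hzy
        obtain ⟨c, hc⟩ := Subgroup.mem_zpowers_iff.mp ((mem_dC_iff _ _).mp (mem_liftU.mp hz.2))
        exact ⟨c, by rw [← Tors.pt_zpow, hc]; rfl⟩
      · rintro ⟨c, hc⟩
        refine ⟨y, ⟨mem_liftU.mpr ((mem_dX_iff _).mpr hy2), mem_liftU.mpr ((mem_dC_iff _ _).mpr ?_)⟩, rfl⟩
        exact Subgroup.mem_zpowers_iff.mpr ⟨c, Tors.pt_injective (by rw [Tors.pt_zpow, ← hc]; rfl)⟩ }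

omit [NumberField F] [E.IsElliptic] in
/-- Powers of a single-point inertia generator have trivial torsion coordinate. [cite: Mochizuki2012, IUTchI §1 p.37] -/
theorem left_right_eq_one_of_mem_zpowers_igenP {g : Tors E Fbar l}
    (s : Tors E Fbar l ⧸ Subgroup.zpowers g → Tors E Fbar l) (q : Tors E Fbar l ⧸ Subgroup.zpowers g)
    {d : TorsionCuspModel.DihU F E Fbar l} (hd : d ∈ Subgroup.zpowers (igenP (F := F) s q)) : d.left.right = 1 := by
  obtain ⟨n, rfl⟩ := Subgroup.mem_zpowers_iff.mp hd
  rw [igenP, ← map_zpow, ← map_zpow, SemidirectProduct.left_inl, SemidirectProduct.right_inl]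

/-- **The UNRAMIFIED `l`-torsion monodromy term of `regeom₄`**: `τ` kills every (single-point) cusp inertia group.
[cite: Mochizuki2012, IUTchI §1 p.37] -/
def unramifiedTorsionMonodromyRegeom₄ (D₀ : InitialThetaData F K Fbar E l Pb) :
    D₀.regeom₄.UnramifiedTorsionMonodromy :=
  ⟨D₀.torsionMonodromyRegeom₄, fun x k hk => by
    have h1 : (k : galoisSubgroupOf F K Fbar × TorsionCuspModel.DihU F E Fbar l).2.left.right = 1 :=
      left_right_eq_one_of_mem_zpowers_igenP _ x (mem_liftU.mp hk.1)
    show Tors.pt (tc (embK₃ D₀.fixesTorsion_of_mem_galoisSubgroupOf k)) = 0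
    rw [tc, embK₃_left, h1, Tors.pt_one]⟩

/-- **abc-iut-L5-t1's `CuspGalois` at `regeom₄`**. [cite: Mochizuki2012, IUTchI §1 p.37] -/
def cuspGaloisRegeom₄ (D₀ : InitialThetaData F K Fbar E l Pb) : D₀.regeom₄.geom.pe.CuspGalois :=
  haveI := D₀.isAlgClosure
  haveI := D₀.isScalarTower
  haveI : NeZero l := ⟨D₀.l_prime.ne_zero⟩
  haveI : CompactSpace (galoisSubgroupOf F K Fbar) :=
    isCompact_iff_compactSpace.mp (ThetaGeometryModel.isClosed_galoisSubgroupOf F K Fbar).isCompact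
  TorsionCuspModel.cuspGalois₄ (galoisSubgroupOf F K Fbar) Quotient.out D₀.coGen D₀.l_prime D₀.coGen_not_mem
    D₀.five_le_l (coprime_six_of_prime l D₀.l_prime D₀.five_le_l) D₀.lineGen_ne_one D₀.card_tors_eq QuotientGroup.out_eq'

/-- `regeom₄` has the same `V^bad_mod` and `V̲` as `D₀`. [cite: Mochizuki2012, IUTchI Def 3.1 (e)(f) p.62] -/
theorem regeom₄_VbadMod (D₀ : InitialThetaData F K Fbar E l Pb) : D₀.regeom₄.VbadMod = D₀.VbadMod := rfl

/-- [cite: Mochizuki2012, IUTchI Def 3.1 (f) p.62] -/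
theorem regeom₄_V (D₀ : InitialThetaData F K Fbar E l Pb) : D₀.regeom₄.V = D₀.V := rfl

/-- **`{CG, M′}` jointly at `regeom₄`** (the `∃`-form over the same `(V^bad_mod, V̲)` is B4's
`exists_cuspGalois_and_unramifiedTorsionMonodromy`). [cite: Mochizuki2012, IUTchI Def 6.1 (v) p.158] -/
theorem nonempty_cuspGalois_and_unramified_regeom₄ (D₀ : InitialThetaData F K Fbar E l Pb) :
    Nonempty D₀.regeom₄.geom.pe.CuspGalois ∧ Nonempty D₀.regeom₄.UnramifiedTorsionMonodromy :=
  ⟨⟨D₀.cuspGaloisRegeom₄⟩, ⟨D₀.unramifiedTorsionMonodromyRegeom₄⟩⟩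

end InitialThetaData

end Literature.IUT.HodgeTheaters

end
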